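import Summits.SmoothPoincare4.SmoothPoincare4.Theorems.EntropyRungBakryEmeryLogSobolev
import Literature.Geometry.Riemannian.BakryEmeryLogSobolevSemigroup
import HarnessLib

/-!
# SmoothPoincare4 / EntropyRung — `BakryEmeryLogSobolev` from the heat semigroup
# (item stmt-SmoothPoincare4-16587)

The support item `BakryEmeryLogSobolev` (the textbook Bakry–Émery logarithmic Sobolev inequality of a
complete `CD(K, ∞)` weighted manifold, `K > 0`) is equivalent to the Literature named fact
`bakryEmery_logSobolev_complete` (`bakryEmeryLogSobolev_of_fact`, `EntropyRungBakryEmeryLogSobolev.lean`).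
That fact is now PROVED in the tree from the single upstream named fact
`Literature.Geometry.Riemannian.weightedHeatSemigroup_strongGradientBound_complete`
(`WeightedHeatSemigroupComplete.lean`: the heat semigroup `e^{tL}`, `L = Δ_g − ∇V·∇`, of the complete
weighted manifold — Markov property, invariance of `e^{-V}dV_g`, the heat equation for data constant
outside a compact set, and the strong gradient bound `√Γ(P_t f) ≤ e^{-Kt}P_t√Γ f` of
Bakry–Gentil–Ledoux 2014, Thm. 3.2.4), by `bakryEmery_logSobolev_complete_of_heatSemigroup`
(`BakryEmeryLogSobolevSemigroup.lean`; the Bakry–Émery entropy argument with Gaffney cut-offs, Markov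
Cauchy–Schwarz, de Bruijn's identity and convergence to equilibrium on the non-compact manifold:
`WeightedGreenComplete.lean`, `MarkovOperatorBounds.lean`, `WeightedHeatFlowCompleteDecay.lean`,
`WeightedHeatFlowCompleteEntropy.lean`). Hence:

* `bakryEmeryLogSobolev_of_heatSemigroup` — **the item from the heat-semigroup fact** (so the item
  closes by `bakryEmeryLogSobolev_of_heatSemigroup weightedHeatSemigroup_strongGradientBound_complete_holds`
  the moment that fact — pure linear parabolic theory, no entropy — is discharged).

References: [BakryGentilLedoux2014] Thm. 3.2.4 (p. 144), Prop. 5.7.1 (p. 268); [CarrilloNi2009] Thm. 3.1.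
-/

noncomputable section

-- the registered namespace `Summit.SmoothPoincare4.SmoothPoincare4.Theorems` repeats a component
set_option linter.dupNamespace false

open scoped Manifold ContDiff ENNReal NNReal Topology
open MeasureTheory Set Filter
open Literature.Geometry.Lorentzian Literature.Geometry.Riemannian

namespace Summit.SmoothPoincare4.SmoothPoincare4.Theorems

open Summit.SmoothPoincare4.SmoothPoincare4.Theses.EntropyRung

/-- **The item `BakryEmeryLogSobolev` from the heat semigroup of the complete weighted manifold**:
`weightedHeatSemigroup_strongGradientBound_complete` (Bakry–Gentil–Ledoux 2014, Thm. 3.2.4/3.2.6: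
existence, Markov property, invariance and strong gradient bound of `e^{tL}` on a complete `CD(K, ∞)`
weighted manifold) implies the route's support statement, through
`bakryEmery_logSobolev_complete_of_heatSemigroup` (the Bakry–Émery argument proved on the complete
manifold) and the bridge `bakryEmeryLogSobolev_of_fact`.
[cite: BakryGentilLedoux2014, Thm. 3.2.4 (p. 144) and Prop. 5.7.1 (p. 268)] [cite: CarrilloNi2009, Thm. 3.1 (p. 7)] -/
theorem bakryEmeryLogSobolev_of_heatSemigroup
    (h : weightedHeatSemigroup_strongGradientBound_complete) :
    Summit.SmoothPoincare4.SmoothPoincare4.Theses.EntropyRung.BakryEmeryLogSobolev :=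
  bakryEmeryLogSobolev_of_fact (bakryEmery_logSobolev_complete_of_heatSemigroup h)

end Summit.SmoothPoincare4.SmoothPoincare4.Theorems

end
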